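import Summits.ResolutionOfSingularities.ResolutionOfSingularities.Theorems.WeightedInvariantTieFiniteTopology
import Summits.ResolutionOfSingularities.ResolutionOfSingularities.Theorems.WeightedInvariantIota3Tie
import Summits.ResolutionOfSingularities.ResolutionOfSingularities.Theorems.WeightedInvariantIota3EpsTopStratum
import HarnessLib

/-!
# Finiteness of the tie points, reduction to the curves: the generic point `η(z)` of the top stratum through a tie
# point, its maximality in `{ν ≥ ν(z)}`, and «tie points finite ⟸ finitely many on each curve near its generic point» —
# door `HypersurfaceCentreConstruction` (stmt-ResolutionOfSingularities-19897), route `WeightedInvariant`, P3 rung `KeyRungLE 3 p`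

[OURS · L1 W4.3 · cell `res-hironaka`, HUMAN RULING D-0089] Helper file `--supports stmt-ResolutionOfSingularities-19897`
(res-type-047, deliverable (D2) «FINITENESS OF THE TIE POINTS», res-L1-w43-plan-1 RULING gen 11 #5).  This file reduces the
finiteness of the set `T = {z | IsTiePosition 𝒪_{Y,z} f_z}` (res-type-092's tie predicate, p531400) on a smooth
quasi-compact `Y` over a field to ONE local statement per curve: «near the generic point `η` of the top stratum through a tie
point, the tie points `z` with `η ⤳ z`, `ν(z) = ν(η)` are finitely many» — the Chevalley step (global cylinder move of
res-D-brk-1 p535624 + the no-drop successor of a tie + generic drop), typed separately.  CANDIDATE DESIGN OBJECTS ONLY; nothing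
here is a statement of the manuscript under review (Hironaka 2017, [claim: Hironaka2017, status: under-review]); nothing is
attributed to its author; nothing here claims anything about resolution of singularities.  AI work, weaker than expert review.

## What is proved (def-free; `ν = iotaOrd`, `(ν;ε) = Iota3.iotaOrdEps` at the stalk germs of `f ∈ Γ(Y, 𝒪_Y)`)

* §1 `exists_generization_of_prime` — THE GENERIZATION CHART: for a point `z` of a scheme `Y` and a prime `𝔭` of
  `𝒪_{Y,z}` there is a point `η ⤳ z` such that (i) every iso-invariant predicate of the position transfers,
  `P ((𝒪_{Y,z})_𝔭, f_z/1) ↔ P (𝒪_{Y,η}, f_η)`, and (ii) every generization `θ ⤳ η`, `θ ≠ η`, is read on a prime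
  `𝔮 < 𝔭` of `𝒪_{Y,z}` in the same way (affine chart: `η = fromSpec (𝔭 ∩ Γ(Y,U))`; res-type-047's dictionary p532195).
* §2 `IsTiePosition.ne_zero` / `.mem_maximalIdeal` — a tie position's equation is a non-zero non-unit (`0 < ℓ = rν` in the
  lex-max datum); `exists_curve_of_isTiePosition` — **for a tie point `z`: a point `η ⤳ z` with `ν(η) = ν(z)` (natural
  number) which is MAXIMAL in the closed set `{ν(η) ≤ ν}`** (`η` = the generic point of the top `(ν;ε)`-stratum `V(P₀)`
  of res-type-078's `topStratumPrime_iotaOrdEps_spec`: a generization `θ ≠ η` of `η` is a prime `𝔮 < P₀`, off `V(P₀)`, so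
  `(ν;ε)` drops there ((c7) for `(ν;ε)`, p528033), and with `ε(z) = 0` it is `ν` that drops).
* §3 **`tiePoints_finite_of_curveFinite`** — on a smooth quasi-compact `Y` over a field: if for every point `η` that is
  maximal in `{ν(η) ≤ ν}` and specialises to a tie point of the same order there is an open `V ∋ η` with
  `{z ∈ T | η ⤳ z, ν(z) = ν(η)} ∩ V` finite and `closure {η} ∖ V` finite, then `T` is finite (finitely many order values
  by `TieFinite.exists_forall_lt_of_isClosed_superlevel` + (c8) for `ν`; finitely many maximal points per value by
  `TieFinite.finite_setOf_isMaximalIn`; `TieFinite.finite_of_subset_biUnion_closure`).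

## References

* res-L1-w43-plan-1, RULING gen 11 #5 (HOME/STATUS 2026-08-27T13:06:46Z), `L/res-L1-w43-plan-1/IOTA3-DESIGN.md` v1.3.1 §8.5
  (OURS, AI planning); res-type-092 `…Iota3Tie` (p531400); res-type-078 `…Iota3EpsTopStratum` (p528738), `…Iota3EpsStrat`
  (p528033); res-type-013 `…Iota3Eps` (p527087).
-/

noncomputable section

set_option linter.dupNamespace false -- mandated namespace `Summit.<Summit>.<Problem>` of this single-conjunct summit

open CategoryTheory AlgebraicGeometry TopologicalSpace IsLocalRing Topology
open Literature.AlgebraicGeometry.Resolution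
open Summit.ResolutionOfSingularities.ResolutionOfSingularities.Theorems (ContactCylinder.topStratum ContactCylinder.topStratumPrime)

namespace Summit.ResolutionOfSingularities.ResolutionOfSingularities.Cruxes.HypersurfaceCentreConstruction.LocalEngine

namespace TieFinite

/-! ## §1 The generization chart: a prime of `𝒪_{Y,z}` as a point `η ⤳ z`, and the generizations of `η` -/

section Chart

variable {Y : Scheme.{0}}

/-- **The generization chart.**  For a point `z` of a scheme `Y`, a global function `f` and a prime `𝔭` of `𝒪_{Y,z}`:
there is a point `η ⤳ z` such that every iso-invariant predicate of the position `((𝒪_{Y,z})_𝔭, f_z/1)` is the same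
predicate of `(𝒪_{Y,η}, f_η)`, and every generization `θ ≠ η` of `η` is read in the same way on a prime `𝔮 < 𝔭` of
`𝒪_{Y,z}`. [OURS] -/
theorem exists_generization_of_prime (f : Γ(Y, ⊤)) (z : Y) (𝔭 : PrimeSpectrum (Y.presheaf.stalk z)) :
    ∃ η : Y, η ⤳ z ∧
      (∀ (P : (R : Type) → [CommRing R] → R → Prop),
        (∀ (R T : Type) [CommRing R] [CommRing T] (e : R ≃+* T) (g : R), P R g ↔ P T (e g)) →
        (P (Localization.AtPrime 𝔭.asIdeal)
            (algebraMap (Y.presheaf.stalk z) (Localization.AtPrime 𝔭.asIdeal) ((Y.presheaf.germ ⊤ z trivial) f)) ↔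
          P (Y.presheaf.stalk η) ((Y.presheaf.germ ⊤ η trivial) f))) ∧
      (∀ θ : Y, θ ⤳ η → θ ≠ η → ∃ 𝔮 : PrimeSpectrum (Y.presheaf.stalk z), 𝔮.asIdeal < 𝔭.asIdeal ∧
        ∀ (P : (R : Type) → [CommRing R] → R → Prop),
          (∀ (R T : Type) [CommRing R] [CommRing T] (e : R ≃+* T) (g : R), P R g ↔ P T (e g)) →
          (P (Localization.AtPrime 𝔮.asIdeal)
              (algebraMap (Y.presheaf.stalk z) (Localization.AtPrime 𝔮.asIdeal) ((Y.presheaf.germ ⊤ z trivial) f)) ↔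
            P (Y.presheaf.stalk θ) ((Y.presheaf.germ ⊤ θ trivial) f))) := by
  -- an affine chart through `z`
  have hztop : z ∈ (⊤ : Y.Opens) := trivial
  rw [← iSup_affineOpens_eq_top Y] at hztop
  obtain ⟨U, hz⟩ := Opens.mem_iSup.mp hztop
  letI algz := TopCat.Presheaf.algebra_section_stalk Y.presheaf (⟨z, hz⟩ : (U : Y.Opens))
  haveI hlocz : IsLocalization.AtPrime (Y.presheaf.stalk z) (U.2.primeIdealOf ⟨z, hz⟩).asIdeal :=
    U.2.isLocalization_stalk ⟨z, hz⟩
  -- `q = 𝔭 ∩ Γ(Y,U)`, `η = fromSpec q`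
  set q : PrimeSpectrum Γ(Y, U) :=
    ⟨𝔭.asIdeal.comap (algebraMap Γ(Y, U) (Y.presheaf.stalk z)), inferInstance⟩ with hq
  have hqle : q.asIdeal ≤ (U.2.primeIdealOf ⟨z, hz⟩).asIdeal :=
    Iota3.comap_le_of_isLocalization_atPrime (U.2.primeIdealOf ⟨z, hz⟩).asIdeal (Y.presheaf.stalk z) 𝔭.asIdeal
  have hηU : U.2.fromSpec q ∈ (U : Y.Opens) := Iota3.fromSpec_mem U q
  have hpη : U.2.primeIdealOf ⟨U.2.fromSpec q, hηU⟩ = q := Iota3.primeIdealOf_fromSpec U q hηU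
  refine ⟨U.2.fromSpec q, (GenerizationClosed.le_primeIdealOf_iff_specializes U hz q).mp hqle, ?_, ?_⟩
  · intro P hP
    exact GenerizationClosed.localization_stalk_iff P U hP f hz 𝔭 hηU (U.2.isLocalization_stalk' q hηU)
  · intro θ hθη hne
    have hθU : θ ∈ (U : Y.Opens) := hθη.mem_open U.1.isOpen hηU
    letI algθ := TopCat.Presheaf.algebra_section_stalk Y.presheaf (⟨θ, hθU⟩ : (U : Y.Opens))
    haveI hlocθ : IsLocalization.AtPrime (Y.presheaf.stalk θ) (U.2.primeIdealOf ⟨θ, hθU⟩).asIdeal :=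
      U.2.isLocalization_stalk ⟨θ, hθU⟩
    -- `q_θ ≤ q ≤ 𝔭_z`
    have hθq : (U.2.primeIdealOf ⟨θ, hθU⟩).asIdeal ≤ q.asIdeal := by
      have h := primeIdealOf_le_of_specializes U hηU hθU hθη
      rwa [hpη] at h
    have hθz : (U.2.primeIdealOf ⟨θ, hθU⟩).asIdeal ≤ (U.2.primeIdealOf ⟨z, hz⟩).asIdeal := hθq.trans hqle
    have hdisj : Disjoint ((U.2.primeIdealOf ⟨z, hz⟩).asIdeal.primeCompl : Set Γ(Y, U))
        ((U.2.primeIdealOf ⟨θ, hθU⟩).asIdeal : Set Γ(Y, U)) := by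
      rw [Set.disjoint_left]
      intro a ha ha'
      exact ha (hθz ha')
    -- the prime `𝔮 = q_θ · 𝒪_{Y,z}`
    set 𝔔 : Ideal (Y.presheaf.stalk z) :=
      (U.2.primeIdealOf ⟨θ, hθU⟩).asIdeal.map (algebraMap Γ(Y, U) (Y.presheaf.stalk z)) with h𝔔
    haveI h𝔔p : 𝔔.IsPrime :=
      IsLocalization.isPrime_of_isPrime_disjoint (U.2.primeIdealOf ⟨z, hz⟩).asIdeal.primeCompl _ _ inferInstance hdisj
    have hcomap : 𝔔.comap (algebraMap Γ(Y, U) (Y.presheaf.stalk z)) = (U.2.primeIdealOf ⟨θ, hθU⟩).asIdeal :=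
      IsLocalization.under_map_of_isPrime_disjoint _ _ inferInstance hdisj
    refine ⟨⟨𝔔, h𝔔p⟩, ?_, ?_⟩
    · -- `𝔮 < 𝔭`: `𝔮 ≤ 𝔭` since `q_θ ≤ q = 𝔭 ∩ Γ(Y,U)` and `𝔭 = (𝔭 ∩ Γ(Y,U)) · 𝒪`; `𝔮 ≠ 𝔭` since `θ ≠ η`
      refine lt_of_le_of_ne ?_ ?_
      · calc 𝔔 ≤ q.asIdeal.map (algebraMap Γ(Y, U) (Y.presheaf.stalk z)) := Ideal.map_mono hθq
          _ = 𝔭.asIdeal := IsLocalization.map_under (U.2.primeIdealOf ⟨z, hz⟩).asIdeal.primeCompl _ 𝔭.asIdeal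
      · intro heq
        apply hne
        have heq' : 𝔔 = 𝔭.asIdeal := heq
        have h1 : (U.2.primeIdealOf ⟨θ, hθU⟩).asIdeal = q.asIdeal := by
          rw [← hcomap, heq']
        have h2 : U.2.primeIdealOf ⟨θ, hθU⟩ = q := PrimeSpectrum.ext h1
        have h3 := U.2.fromSpec_primeIdealOf ⟨θ, hθU⟩
        rw [h2] at h3
        exact h3.symm
    · intro P hP
      have hM : (𝔔.comap (algebraMap Γ(Y, U) (Y.presheaf.stalk z))).primeCompl =
          (U.2.primeIdealOf ⟨θ, hθU⟩).asIdeal.primeCompl := by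
        ext a; simp only [Ideal.mem_primeCompl_iff, hcomap]
      have hloc : IsLocalization (𝔔.comap (algebraMap Γ(Y, U) (Y.presheaf.stalk z))).primeCompl (Y.presheaf.stalk θ) := by
        rw [hM]
        exact hlocθ
      exact GenerizationClosed.localization_stalk_iff P U hP f hz ⟨𝔔, h𝔔p⟩ hθU hloc

end Chart

/-! ## §2 The curve of a tie point: the generic point of the top `(ν;ε)`-stratum, maximal in `{ν(z) ≤ ν}` -/

section TieCurve

/-- A tie presentation's level is positive: `0 < r·ν`, so `1 ≤ ν`. [OURS] -/
theorem IsTiePresentation.one_le {S : Type} [CommRing S] [IsLocalRing S] {f x y z : S} {q r : ℕ} {lam : S}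
    (h : Iota3.IsTiePresentation S f x y z q r lam) :
    ∃ ν : ℕ, 1 ≤ ν ∧ f ∈ maximalIdeal S ^ ν ∧ f ∉ maximalIdeal S ^ (ν + 1) := by
  obtain ⟨-, -, ν, hP, hfν, hfν', hlex, -⟩ := h
  refine ⟨ν, ?_, hfν, hfν'⟩
  obtain ⟨-, -, -, -, hℓ, -⟩ := hlex
  rcases Nat.eq_zero_or_pos ν with h0 | hpos
  · rw [h0, mul_zero] at hℓ; exact absurd hℓ (Nat.lt_irrefl 0)
  · exact hpos

/-- A tie position's equation is non-zero. [OURS] -/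
theorem IsTiePosition.ne_zero {S : Type} [CommRing S] {f : S} (h : Iota3.IsTiePosition S f) : f ≠ 0 := by
  obtain ⟨hreg, -, -, -, x, y, z, q, r, lam, hpres⟩ := h
  obtain ⟨ν, -, -, hfν'⟩ := IsTiePresentation.one_le hpres
  rintro rfl
  exact hfν' (Ideal.zero_mem _)

/-- A tie position's equation is a non-unit. [OURS] -/
theorem IsTiePosition.mem_maximalIdeal {S : Type} [CommRing S] {f : S} (h : Iota3.IsTiePosition S f) :
    ∃ _ : IsRegularLocalRing S, f ∈ maximalIdeal S := by
  obtain ⟨hreg, -, -, -, x, y, z, q, r, lam, hpres⟩ := h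
  obtain ⟨ν, hν, hfν, -⟩ := IsTiePresentation.one_le hpres
  exact ⟨hreg, Ideal.pow_le_self (by omega) hfν⟩

/-- The order of a tie position is a natural number `ν ≥ 1`, and `ε = 0`, `dim = 3`. [OURS] -/
theorem IsTiePosition.exists_iotaOrd_eq {S : Type} [CommRing S] {f : S} (h : Iota3.IsTiePosition S f) :
    ∃ (_ : IsRegularLocalRing S) (ν : ℕ), 1 ≤ ν ∧ iotaOrd S f = ν ∧ Iota3.iotaEps S f = 0 ∧ ringKrullDim S = 3 := by
  obtain ⟨hreg, hdim, heps, -, x, y, z, q, r, lam, hpres⟩ := h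
  obtain ⟨ν, hν, hfν, hfν'⟩ := IsTiePresentation.one_le hpres
  exact ⟨hreg, ν, hν, (iotaOrd_eq_natCast_iff S f ν).mpr ⟨hfν, hfν'⟩, heps, hdim⟩

/-- **Ring form of the curve of a tie point.**  For a tie position `(S, g)` with `ν = iotaOrd S g`: the generic prime `P₀` of
the top `(ν;ε)`-stratum is prime, the order at `S_{P₀}` is `ν`, and at every prime `𝔮` NOT above `P₀` the order is `< ν`
(the pair `(ν;ε)` does not increase under generization and differs from `(ν; 0)` off `V(P₀)`). [OURS] -/
theorem IsTiePosition.iotaOrd_localization_lt {S : Type} [CommRing S] {g : S} (hz : Iota3.IsTiePosition S g) :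
    ∃ (ν : ℕ) (_ : (ContactCylinder.topStratumPrime Iota3.iotaOrdEps S g).IsPrime),
      iotaOrd S g = ν ∧
      iotaOrd (Localization.AtPrime (ContactCylinder.topStratumPrime Iota3.iotaOrdEps S g))
        (algebraMap S (Localization.AtPrime (ContactCylinder.topStratumPrime Iota3.iotaOrdEps S g)) g) = ν ∧
      ∀ (𝔮 : Ideal S) [𝔮.IsPrime], ¬ ContactCylinder.topStratumPrime Iota3.iotaOrdEps S g ≤ 𝔮 →
        iotaOrd (Localization.AtPrime 𝔮) (algebraMap S (Localization.AtPrime 𝔮) g) < ν := by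
  obtain ⟨hreg, ν, hν1, hνeq, heps, hdim⟩ := IsTiePosition.exists_iotaOrd_eq hz
  obtain ⟨_, hgm⟩ := IsTiePosition.mem_maximalIdeal hz
  have hg0 : g ≠ 0 := IsTiePosition.ne_zero hz
  obtain ⟨hP₀, -, -, hS₀, -, -⟩ := Iota3.topStratumPrime_iotaOrdEps_spec (S := S) (le_of_eq hdim) hg0 hgm hνeq
  refine ⟨ν, hP₀, hνeq, ?_, fun 𝔮 _ hnot => ?_⟩
  · -- `P₀` lies in the top stratum
    have hP₀top : (⟨ContactCylinder.topStratumPrime Iota3.iotaOrdEps S g, hP₀⟩ : PrimeSpectrum S) ∈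
        ContactCylinder.topStratum Iota3.iotaOrdEps S g := by
      rw [hS₀]
      exact (le_refl (ContactCylinder.topStratumPrime Iota3.iotaOrdEps S g) :)
    have hpair := (Theorems.ContactCylinder.mem_topStratum_iff Iota3.iotaOrdEps S g _).mp hP₀top
    rw [← hνeq]
    exact ((Iota3.iotaOrdEps_eq_iff _ _ _ _).mp hpair).1
  · -- off `V(P₀)`: the pair drops, and since `ε(S) = 0` it is `ν` that drops
    have hne' : Iota3.iotaOrdEps (Localization.AtPrime 𝔮) (algebraMap S _ g) ≠ Iota3.iotaOrdEps S g := by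
      intro heq
      have hmem : (⟨𝔮, inferInstance⟩ : PrimeSpectrum S) ∈ ContactCylinder.topStratum Iota3.iotaOrdEps S g :=
        (Theorems.ContactCylinder.mem_topStratum_iff Iota3.iotaOrdEps S g _).mpr heq
      rw [hS₀] at hmem
      exact hnot hmem
    have hle : Iota3.iotaOrdEps (Localization.AtPrime 𝔮) (algebraMap S _ g) ≤ Iota3.iotaOrdEps S g :=
      Iota3.iotaOrdEps_generizationMonotone S 𝔮 g
    have hlt := lt_of_le_of_ne hle hne'
    rw [Iota3.iotaOrdEps_lt_iff, hνeq, heps] at hlt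
    rcases hlt with h | ⟨-, h⟩
    · exact h
    · exact absurd h (not_lt_of_ge bot_le)

variable {Y : Scheme.{0}}

/-- **The curve of a tie point.**  For a tie point `z` of `(Y, f)` there is a point `η ⤳ z` with `ν(η) = ν(z) ∈ ℕ` which is
MAXIMAL in the closed set `{y | ν(z) ≤ ν(y)}`: `η` is the generic point of the top `(ν;ε)`-stratum `V(P₀)` through `z`
(res-type-078's `topStratumPrime_iotaOrdEps_spec`), and at a proper generization `θ` of `η` — a prime `𝔮 < P₀` of
`𝒪_{Y,z}`, off `V(P₀)` — the pair `(ν;ε)` is strictly smaller than `(ν(z); 0)` ((c7) for `(ν;ε)`,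
`iotaOrdEps_generizationMonotone`), hence `ν(θ) < ν(z)`. [OURS] -/
theorem exists_curve_of_isTiePosition (f : Γ(Y, ⊤)) {z : Y}
    (hz : Iota3.IsTiePosition (Y.presheaf.stalk z) ((Y.presheaf.germ ⊤ z trivial) f)) :
    ∃ (η : Y) (n : ℕ), η ⤳ z ∧
      iotaOrd (Y.presheaf.stalk z) ((Y.presheaf.germ ⊤ z trivial) f) = n ∧
      iotaOrd (Y.presheaf.stalk η) ((Y.presheaf.germ ⊤ η trivial) f) = n ∧
      ∀ θ : Y, θ ⤳ η → θ ≠ η → iotaOrd (Y.presheaf.stalk θ) ((Y.presheaf.germ ⊤ θ trivial) f) < n := by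
  obtain ⟨ν, hP₀, hνeq, hνP₀, hdrop⟩ := IsTiePosition.iotaOrd_localization_lt hz
  -- the point `η` of the prime `P₀`
  obtain ⟨η, hηz, htrans, hgen⟩ := exists_generization_of_prime f z ⟨_, hP₀⟩
  have hνη : iotaOrd (Y.presheaf.stalk η) ((Y.presheaf.germ ⊤ η trivial) f) = ν :=
    (htrans (fun R _ g => iotaOrd R g = ν) (fun R T _ _ e g => by rw [iotaOrd_isoInvariant R T e g])).mp hνP₀
  refine ⟨η, ν, hηz, hνeq, hνη, fun θ hθη hne => ?_⟩
  obtain ⟨𝔮, h𝔮lt, htransθ⟩ := hgen θ hθη hne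
  have hnotle : ¬ ContactCylinder.topStratumPrime Iota3.iotaOrdEps _ _ ≤ 𝔮.asIdeal :=
    fun hle => (lt_irrefl _) (lt_of_lt_of_le h𝔮lt hle)
  have hν𝔮 := hdrop 𝔮.asIdeal hnotle
  -- transfer to `θ`
  have hθm : iotaOrd (Y.presheaf.stalk θ) ((Y.presheaf.germ ⊤ θ trivial) f) =
      iotaOrd (Localization.AtPrime 𝔮.asIdeal) (algebraMap _ (Localization.AtPrime 𝔮.asIdeal)
        ((Y.presheaf.germ ⊤ z trivial) f)) :=
    (htransθ (fun R _ g => iotaOrd R g = iotaOrd (Localization.AtPrime 𝔮.asIdeal)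
        (algebraMap _ (Localization.AtPrime 𝔮.asIdeal) ((Y.presheaf.germ ⊤ z trivial) f)))
      (fun R T _ _ e g => by rw [iotaOrd_isoInvariant R T e g])).mp rfl
  rw [hθm]
  exact hν𝔮

end TieCurve

/-! ## §3 The reduction: tie points finite ⟸ finitely many on each curve near its generic point -/

section Reduction

variable {k₀ : Type} [Field k₀] {Y : Scheme.{0}} (hY : Y ⟶ Spec (CommRingCat.of k₀)) [Smooth hY] [QuasiCompact hY]

include hY in
/-- **Tie points are finite as soon as they are finite on each curve near its generic point.**  On a smooth quasi-compact
`Y` over a field: if for every point `η` that is maximal in `{y | ν(η) ≤ ν(y)}` and specialises to SOME tie point of the same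
order there is an open `V ∋ η` such that the tie points `z` with `η ⤳ z`, `ν(z) = ν(η)` lying in `V` are finitely many and
`closure {η} ∖ V` is finite, then the set of tie points of `(Y, f)` is finite.  (The hypothesis is the Chevalley step of
RULING gen 11 #5, typed separately over res-D-brk-1's global cylinder move.) [OURS] -/
theorem tiePoints_finite_of_curveFinite (f : Γ(Y, ⊤))
    (hcurve : ∀ (η : Y) (n : ℕ), iotaOrd (Y.presheaf.stalk η) ((Y.presheaf.germ ⊤ η trivial) f) = n →
      (∀ θ : Y, θ ⤳ η → θ ≠ η → iotaOrd (Y.presheaf.stalk θ) ((Y.presheaf.germ ⊤ θ trivial) f) < n) →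
      (∃ z : Y, Iota3.IsTiePosition (Y.presheaf.stalk z) ((Y.presheaf.germ ⊤ z trivial) f) ∧ η ⤳ z ∧
        iotaOrd (Y.presheaf.stalk z) ((Y.presheaf.germ ⊤ z trivial) f) = n) →
      ∃ V : Set Y, IsOpen V ∧ η ∈ V ∧
        ({z : Y | Iota3.IsTiePosition (Y.presheaf.stalk z) ((Y.presheaf.germ ⊤ z trivial) f) ∧ η ⤳ z ∧
            iotaOrd (Y.presheaf.stalk z) ((Y.presheaf.germ ⊤ z trivial) f) = n} ∩ V).Finite ∧
        (closure {η} \ V).Finite) :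
    {z : Y | Iota3.IsTiePosition (Y.presheaf.stalk z) ((Y.presheaf.germ ⊤ z trivial) f)}.Finite := by
  classical
  haveI : NoetherianSpace Y := Theorems.noetherianSpace_of_smooth_quasiCompact hY
  set T : Set Y := {z : Y | Iota3.IsTiePosition (Y.presheaf.stalk z) ((Y.presheaf.germ ⊤ z trivial) f)} with hTdef
  set nu : Y → Ordinal.{0} := fun y => iotaOrd (Y.presheaf.stalk y) ((Y.presheaf.germ ⊤ y trivial) f) with hnudef
  -- the closed super-level sets of `ν` and the set `H` of curve generic points
  have hFclosed : ∀ n : ℕ, IsClosed {y : Y | (n : Ordinal.{0}) ≤ nu y} := fun n =>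
    iotaOrd_upperSemicontinuous k₀ Y hY f n
  set H : Set Y := {η : Y | ∃ n : ℕ, nu η = n ∧ (∀ θ : Y, θ ⤳ η → θ ≠ η → nu θ < n) ∧
    ∃ z : Y, z ∈ T ∧ η ⤳ z ∧ nu z = n} with hHdef
  -- the fibre of `η`: tie points below `η` of the same order
  set Tη : Y → ℕ → Set Y := fun η n => {z : Y | z ∈ T ∧ η ⤳ z ∧ nu z = n} with hTηdef
  -- (1) `T ⊆ ⋃_{η ∈ H} ⋃ n, Tη η n` (with `n = ν η`)
  have hTH : T ⊆ ⋃ η ∈ H, {z : Y | z ∈ T ∧ η ⤳ z ∧ nu z = nu η} := by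
    intro z hz
    obtain ⟨η, n, hηz, hνz, hνη, hmax⟩ := exists_curve_of_isTiePosition f hz
    refine Set.mem_iUnion₂.mpr ⟨η, ⟨n, hνη, hmax, z, hz, hηz, hνz⟩, hz, hηz, ?_⟩
    exact hνz.trans hνη.symm
  -- (2) `H` is finite: its points with value `n` are maximal in the closed set `{n ≤ ν}`, and the values are bounded
  have hHfin : H.Finite := by
    obtain ⟨N, hN⟩ := exists_forall_eq_of_antitone_closeds (X := Y) (fun n : ℕ => {y : Y | (n : Ordinal.{0}) ≤ nu y})
      hFclosed (fun n y hy => by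
        have hy' : ((n + 1 : ℕ) : Ordinal.{0}) ≤ nu y := hy
        exact le_trans (by exact_mod_cast Nat.le_succ n) hy')
    have hval : ∀ η ∈ H, ∃ n : ℕ, n < N + 1 ∧ nu η = n ∧ ∀ θ : Y, θ ⤳ η → θ ≠ η → nu θ < n := by
      rintro η ⟨n, hn, hmax, -⟩
      refine ⟨n, ?_, hn, hmax⟩
      by_contra hge
      have hNn : N ≤ n := by omega
      -- `η ∈ F_n = F_N = F_{n+1}`, contradiction with `ν η = n`
      have h1 : η ∈ {y : Y | ((n : ℕ) : Ordinal.{0}) ≤ nu y} := by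
        change ((n : ℕ) : Ordinal.{0}) ≤ nu η; rw [hn]
      rw [hN n hNn, ← hN (n + 1) (by omega)] at h1
      have h3 : ((n + 1 : ℕ) : Ordinal.{0}) ≤ nu η := h1
      rw [hn] at h3
      have h4 : n + 1 ≤ n := by exact_mod_cast h3
      omega
    refine Set.Finite.subset (Set.Finite.biUnion (Set.finite_lt_nat (N + 1)) fun n _ =>
      finite_setOf_isMaximalIn (X := Y) (hFclosed n)) ?_
    intro η hη
    obtain ⟨n, hnN, hn, hmax⟩ := hval η hη
    refine Set.mem_biUnion hnN ⟨?_, fun θ hθ hθη => ?_⟩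
    · change ((n : ℕ) : Ordinal.{0}) ≤ nu η; rw [hn]
    · by_contra hne
      have hlt := hmax θ hθη hne
      exact absurd hθ (not_le_of_gt hlt)
  -- (3) each fibre is finite: inside `V` by hypothesis, outside `V` inside the finite `closure {η} ∖ V`
  refine (hHfin.biUnion fun η hη => ?_).subset hTH
  obtain ⟨n, hn, hmax, z, hzT, hηz, hνz⟩ := hη
  obtain ⟨V, -, -, hfin, hdiff⟩ := hcurve η n hn hmax ⟨z, hzT, hηz, hνz⟩
  refine (hfin.union hdiff).subset ?_
  rintro t ⟨htT, htη, hνt⟩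
  have hνt' : nu t = n := by rw [hνt]; exact hn
  by_cases htV : t ∈ V
  · exact Or.inl ⟨⟨htT, htη, hνt'⟩, htV⟩
  · exact Or.inr ⟨specializes_iff_mem_closure.mp htη, htV⟩

end Reduction

end TieFinite

end Summit.ResolutionOfSingularities.ResolutionOfSingularities.Cruxes.HypersurfaceCentreConstruction.LocalEngine

end
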